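import Literature.AlgebraicGeometry.Frobenioids.FrobenioidRealification
import Literature.AlgebraicGeometry.Frobenioids.BirationalNormalizationExampleIsFrobenioid
import Literature.AlgebraicGeometry.Frobenioids.BirationalNormalizationExampleRational
import Literature.AlgebraicGeometry.Frobenioids.BirationalNormalizationExampleNotBiratNormalized
import Literature.AlgebraicGeometry.Frobenioids.ModelFrobenioidModelType
import Literature.AlgebraicGeometry.Frobenioids.Prop55SubRatStdSlot
import HarnessLib

/-!
# Frobenioids I, Remark 5.2.1 AT THE Frobenioid of Example 4.6 — PROVED (closer of the schema
# `PreFrobenioid.Remark521_ex46`)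

Mochizuki, *The geometry of Frobenioids I: the general theory*, Kyushu J. Math. **62** (2008)
293–400, §5, Remark 5.2.1 p. 103 [cite: MochizukiFrdI2008, Rem. 5.2.1 p.103]: "It follows formally from
Theorem 5.2, (ii), (iv), that the Frobenioid '`C`' of Example 4.6 constitutes an example of a Frobenioid of
isotropic, standard, and [strictly] rational type, which is not of group-like or model type."

PROOF-ONLY companion of `FrobenioidRealification.lean` (seat abc-iut-L1-t5, node FrdI:Rmk5.2.1 of cell
abc-iut).  The typed statement of record is the SCHEMA `PreFrobenioid.Remark521_ex46 P B₀ Supp` — Remark 5.2.1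
read at THE Frobenioid `Ex46.toElem P : C → F_Φ` of Example 4.6 (seat abc-iut-L1-t8), for a datum `P` all of
whose `ξ_p = Ξ(p)` (`p` prime) are non-zero, over a birationalization datum `B₀` and a support predicate
`Supp`.  This file CLOSES it at THE data: `B₀ := PreFrobenioid.biratData hF hsq` (THE birationalization
`C^birat` of Prop. 4.4, seats abc-iut-L6-t8 / L6-t6, whose `Φ^birat` is the canonical rational-function
subfunctor) and `Supp := PrimarySupp` (Def. 2.4 (i)(d) read on primary elements, the cell's canonical support
predicate, `Prop55SubRatStdSlot.lean`).  ASSEMBLY ONLY — the six conjuncts are kernel theorems of seat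
abc-iut-L1-t8's Example 4.6 chain, consumed BY NAME:
* `IsFrobenioid` — `Ex46.isFrobenioid`; isotropic type — `Ex46.isOfIsotropicType`; standard type —
  `Ex46.isOfStandardType` (`BirationalNormalizationExampleIsFrobenioid.lean`);
* strictly rational type — `Ex46.isStrictlyRational` (`BirationalNormalizationExampleRational.lean`; the
  support axiom it asks of `Supp` is `Iff.rfl` for `PrimarySupp`);
* not of group-like type — `Ex46.not_isOfType_isGroupLikeObj`;
* not of model type (:= pre-model AND birationally Frobenius-normalized, Def. 4.5 (i)) — because `A₀` is not
  birationally Frobenius-normalized as soon as some `Ξ(n) ≠ 0` (`Ex46.not_isBiratFrobeniusNormalized_A₀`,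
  `BirationalNormalizationExampleNotBiratNormalized.lean`; here `n = 2`, `Ξ(2) = ξ₂ ≠ 0`), transported to seat
  abc-iut-L1-t3's operations-level Def. 4.5 (i) by `isBiratFrobeniusNormalized_iff_biratData`
  (`ModelFrobenioidModelType.lean`).
Also recorded: the same conclusion under the weaker hypothesis "some `Ξ(n) ≠ 0`" (`remark521_ex46_of_ne_zero`,
a proved generalisation — print's case is "the `ξ_p ≠ 0`").  DISCLOSURE: print derives "not of model type"
"formally from Theorem 5.2, (ii), (iv)"; the kernel route is Example 4.6's own "if the `ξ_p ≠ 0` … then `C`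
fails to be of birationally Frobenius-normalized type" (p. 87), which is what the typed predicate (pre-model ∧
birationally Frobenius-normalized) asks.  No statement of the paper is strengthened.  Nothing here bears on
[IUTchIII] Cor. 3.12.
-/

namespace Literature.AlgebraicGeometry.Frobenioids

namespace PreFrobenioid

open CategoryTheory Opposite

variable {G : Type} [AddCommGroup G] (P : Ex46.Datum G)

/-- **Remark 5.2.1 at THE Frobenioid of Example 4.6, for a datum with SOME `Ξ(n) ≠ 0`** (proved
generalisation of the typed case "all `ξ_p ≠ 0`"): `C` is a Frobenioid of isotropic, standard and strictly
rational type (for THE birationalization and the canonical support predicate), not of group-like type, and not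
of model type. [cite: MochizukiFrdI2008, Rem. 5.2.1 p.103] -/
theorem remark521_ex46_of_ne_zero {n : ℕ+} (hn : P.Ξ n ≠ 0) :
    Literature.AlgebraicGeometry.Frobenioids.PreFrobenioid.Remark521 (Ex46.toElem P)
      (PreFrobenioid.biratData (Ex46.isFrobenioid P)
        (hasBiratSquares_of_isFrobenioid (Ex46.isFrobenioid P)))
      (fun a 𝔭 => PrimarySupp a 𝔭) := by
  refine ⟨Ex46.isFrobenioid P, Ex46.isOfIsotropicType P, Ex46.isOfStandardType P,
    fun A => Ex46.isStrictlyRational P _ _ _ (fun _ _ _ => Iff.rfl) A,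
    Ex46.not_isOfType_isGroupLikeObj P, ?_⟩
  rintro ⟨_, hBFN⟩
  exact Ex46.not_isBiratFrobeniusNormalized_A₀ P hn
    ((isBiratFrobeniusNormalized_iff_biratData (Ex46.A₀ P)).mpr (hBFN.obj (Ex46.A₀ P)))

/-- **[FrdI] Remark 5.2.1 AT THE Frobenioid of Example 4.6** — seat abc-iut-L1-t5's typed schema
`PreFrobenioid.Remark521_ex46 P B₀ Supp` HOLDS at `B₀ :=` THE birationalization datum `biratData` and
`Supp :=` the canonical support predicate `PrimarySupp`: if all `ξ_p = Ξ(p)` (`p` prime) are non-zero, then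
"the Frobenioid '`C`' of Example 4.6 [is] a Frobenioid of isotropic, standard, and [strictly] rational type,
which is not of group-like or model type" (via `ξ₂ ≠ 0`). [cite: MochizukiFrdI2008, Rem. 5.2.1 p.103] -/
theorem remark521_ex46_holds :
    Literature.AlgebraicGeometry.Frobenioids.PreFrobenioid.Remark521_ex46 P
      (PreFrobenioid.biratData (Ex46.isFrobenioid P)
        (hasBiratSquares_of_isFrobenioid (Ex46.isFrobenioid P)))
      (fun a 𝔭 => PrimarySupp a 𝔭) :=
  fun hΞ => remark521_ex46_of_ne_zero P (hΞ 2 Nat.prime_two)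

end PreFrobenioid

end Literature.AlgebraicGeometry.Frobenioids
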